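import Literature.MeasureTheory.Group.TubeJacobianProductCompact                            -- ★ (H4c-2) (this seat): `tubeJacobianLocal_prod_compact` (socket × compact abelian factor)
import Summits.HodgeConjecture.HodgeConjecture.Theorems.F0P3cStCharTSJacCartanWeightDockTwo  -- ★ (H4c-1) p852391 (LH6-p04 (g7)): `tubeJacobianLocal_cartan_U2_elliptic` (the `N = 2` dock: ★ C8b-model through ★ Q9 at compact `Z(γ₀.1)`)
import Summits.HodgeConjecture.HodgeConjecture.Theorems.F0P3cStCharTSUpTrCartanFields        -- ★ (H3b) p852366 (LH4-p01): `mul_eq_mul_iff_commute_endoEmbLocal`, `isLocalGRegular_iff_isRegularElt_endoEmbLocal`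
import Summits.HodgeConjecture.HodgeConjecture.Theorems.F0P3cStCharTSWeylHypMeasure          -- ★ `exists_conjFamily`
import Summits.HodgeConjecture.HodgeConjecture.Theorems.F0P3cStCharTSDGFieldTwo              -- ★ `continuous_dgFormulaTwo` (the `N = 2` radicand is continuous)
import Summits.HodgeConjecture.HodgeConjecture.Theorems.F0P3cStCharTSWeylCartanDatumWIF      -- ★ (E4): `quotientMeasure`, `compactCore`, `PlacesOver`, local-ring letters (the letters' import)
import Literature.NumberTheory.Rogawski1990.LocalNormFibreNonsplit                           -- ★ `IsLocalGRegular.separable_finCharpolyTwo`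
import Literature.NumberTheory.Rogawski1990.LocalTransferUnmatchedLocus                      -- ★ `compactSpace_cmDatum_local_one_of_smul_eq` (`U(Φ₁)(L⁺_v)` compact, non-split `v`)
import Literature.NumberTheory.Automorphic.LocalUnitaryGroupCongrMeasure                     -- ★ instances: `(cmDatum L N H).Local v` locally compact, second countable, Hausdorff
import Literature.NumberTheory.Automorphic.StableCentralizerEquivCM                          -- ★ `commute_of_commute_of_isRegularElt_local`
import HarnessLib

/-!
# F0 · P3c · ROAD «UP-TR» brick (H4c) «JAC-H-CPT»: the compact-Cartan local tube-Jacobian socket on `H_v = U(Φ₂)(L⁺_v) × U(Φ₁)(L⁺_v)`,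
# in the signed C8 letters (Harish-Chandra 1970 Lemma 22; Rogawski 1990 §12.5 pp. 182–183) — UNCONDITIONAL

Cell `pub/hodgecm-mathlib`, crux H413 = `stmt-HodgeConjecture-24833` (lane `--supports … --as helper`); seat LH10-p02 (g10), typing hand of (H4c) (ROAD «UP-TR» DEAL #1,
holder F0P3-p02 (g23) 2026-09-02T18:18:30Z); letters ★-signed by the JAC-ELL lineage LH5-p02 (g7) (sigsheet `JACH-H4c-LETTERS.sigsheet.v1` 1d8f2a85746fa380).
THEOREMS ONLY; sorry-free; no definition ∕ instance ∕ notation ∕ named fact; axioms TRIO.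

WHAT.  `H_v = U(Φ₂)_v × U(Φ₁)_v` at a non-split `v`; `γ₀ ∈ H_v` `G`-regular (`IsLocalGRegular`), `T = Z_H(γ₀)` COMPACT.  Since `U(Φ₁)_v` is a compact ABELIAN direct factor,
`T = Z_{U(Φ₂)}(γ₀.1) × U(Φ₁)_v` and `γ₀.1` is regular in `GL₂`; the socket on `U(Φ₂)_v` at the compact Cartan `Z(γ₀.1)` with weight `√(∏|disc χ_t|·(∏|det t|)⁻¹)`
(★ (H4c-1) `tubeJacobianLocal_cartan_U2_elliptic`, the `N = 2` dock of ★ C8b-model through ★ Q9 — first taken BY SHAPE as the hypothesis `hDock`, ∀ Haar data) and the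
generic product theorem ★ (H4c-2) `Literature.MeasureTheory.Group.tubeJacobianLocal_prod_compact` give the socket on `H_v` at `T` for every Haar `ν` and every Haar torus
measure `tT`, predicate `IsLocalGRegular L v`, weight read through `t.1` — **`tubeJacobianSocket_compactCartan_H_of_dock`** (conclusion = the letters' text token for token)
and the UNCONDITIONAL head **`tubeJacobianSocket_compactCartan_H`** (letters verbatim; `hDock` := ★ (H4c-1) at the place `w ∣ v` fixed by `c̄`).

HONEST LABEL: count-neutral; closes no organ.  HC_CM is proved only modulo the 7 printed citations (2 remaining: hLiu418 = `stmt-HodgeConjecture-24832`,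
h413 = `stmt-HodgeConjecture-24833`) until rung 0 closes.

## References
* [HarishChandra1970] Harish-Chandra (notes by G. van Dijk), *Harmonic analysis on reductive p-adic groups*, LNM 162 (1970), Part V §4 Lemma 22.
* [Rogawski1990] J. D. Rogawski, *Automorphic Representations of Unitary Groups in Three Variables*, Ann. of Math. Stud. 123 (1990), §12.5 pp. 182–183; §4.9 p. 54.
-/

set_option autoImplicit false
-- the mandated namespace has the single-problem summit's repeated segment (`HodgeConjecture.HodgeConjecture`)
set_option linter.dupNamespace false

noncomputable section

open MeasureTheory Measure Set Filter Topology Function NumberField IsDedekindDomain Matrix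
open Literature.MeasureTheory.Group
open Literature.NumberTheory.Automorphic Literature.NumberTheory.Automorphic.UnitaryGroup Literature.NumberTheory.Rogawski1990
open Summit.HodgeConjecture.HodgeConjecture.Cruxes.H413.F0P3cStCharTSUpTrCartanFields
open Summit.HodgeConjecture.HodgeConjecture.Cruxes.H413.F0P3cStCharTSWeylHypMeasure
open scoped ENNReal NNReal MatrixGroups Pointwise

namespace Summit.HodgeConjecture.HodgeConjecture.Cruxes.H413.F0P3cStCharTSUpTrJacCartanCompactH

section CM

variable (L : Type) [Field L] [NumberField L] [IsCMField L] (v : HeightOneSpectrum (𝓞 ↥(maximalRealSubfield L)))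

/-! ## §1 Algebra of the product `H_v = U(Φ₂)_v × U(Φ₁)_v` -/

/-- **`U(Φ₁)(L⁺_v)` is abelian** (a `1 × 1` invertible matrix is its entry). [cite: Rogawski1990, §4.9 p. 55] -/
theorem mul_comm_cmDatum_local_one (a b : ((UnitaryGroup.cmDatum L 1 (Matrix.of fun i j : Fin 1 => if i.val + j.val + 1 = 1 then (1 : L) else 0)).Local v)) : a * b = b * a := by
  apply Subtype.ext
  apply Units.ext
  change (a.val : GL (Fin 1) (UnitaryGroup.LocalRing L v)).val * (b.val : GL (Fin 1) (UnitaryGroup.LocalRing L v)).val =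
    (b.val : GL (Fin 1) (UnitaryGroup.LocalRing L v)).val * (a.val : GL (Fin 1) (UnitaryGroup.LocalRing L v)).val
  ext i j
  fin_cases i; fin_cases j
  simp [Matrix.mul_apply, mul_comm]

/-- **`G`-regular ⇒ the `U(Φ₂)`-part is regular in `GL₂`** (★ `IsLocalGRegular.separable_finCharpolyTwo`). [cite: Rogawski1990, §4.3 p. 42; §4.9 p. 55] -/
theorem isRegularElt_fst_of_isLocalGRegular {s : ((UnitaryGroup.cmDatum L 2 (Matrix.of fun i j : Fin 2 => if i.val + j.val + 1 = 2 then (1 : L) else 0)).Local v × (UnitaryGroup.cmDatum L 1 (Matrix.of fun i j : Fin 1 => if i.val + j.val + 1 = 1 then (1 : L) else 0)).Local v)} (hs : IsLocalGRegular L v s) :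
    IsRegularElt (s.1.val : GL (Fin 2) (UnitaryGroup.LocalRing L v)) :=
  (isRegularElt_iff _).2 (hs.separable_finCharpolyTwo (L := L) (v := v))

/-- **`Z_H(γ₀)` is abelian for `G`-regular `γ₀`** (★ (H3b) `mul_eq_mul_iff_commute_endoEmbLocal` + ★ `commute_of_commute_of_isRegularElt_local`).
[cite: Rogawski1990, §3.1 p. 19; §4.3 p. 42] -/
theorem mul_comm_of_mem_centralizer_of_isLocalGRegular {γ₀ : ((UnitaryGroup.cmDatum L 2 (Matrix.of fun i j : Fin 2 => if i.val + j.val + 1 = 2 then (1 : L) else 0)).Local v × (UnitaryGroup.cmDatum L 1 (Matrix.of fun i j : Fin 1 => if i.val + j.val + 1 = 1 then (1 : L) else 0)).Local v)} (hγ₀ : IsLocalGRegular L v γ₀)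
    (a : ((UnitaryGroup.cmDatum L 2 (Matrix.of fun i j : Fin 2 => if i.val + j.val + 1 = 2 then (1 : L) else 0)).Local v × (UnitaryGroup.cmDatum L 1 (Matrix.of fun i j : Fin 1 => if i.val + j.val + 1 = 1 then (1 : L) else 0)).Local v)) (ha : a ∈ Subgroup.centralizer ({γ₀} : Set ((UnitaryGroup.cmDatum L 2 (Matrix.of fun i j : Fin 2 => if i.val + j.val + 1 = 2 then (1 : L) else 0)).Local v × (UnitaryGroup.cmDatum L 1 (Matrix.of fun i j : Fin 1 => if i.val + j.val + 1 = 1 then (1 : L) else 0)).Local v))) (b : ((UnitaryGroup.cmDatum L 2 (Matrix.of fun i j : Fin 2 => if i.val + j.val + 1 = 2 then (1 : L) else 0)).Local v × (UnitaryGroup.cmDatum L 1 (Matrix.of fun i j : Fin 1 => if i.val + j.val + 1 = 1 then (1 : L) else 0)).Local v)) (hb : b ∈ Subgroup.centralizer ({γ₀} : Set ((UnitaryGroup.cmDatum L 2 (Matrix.of fun i j : Fin 2 => if i.val + j.val + 1 = 2 then (1 : L) else 0)).Local v × (UnitaryGroup.cmDatum L 1 (Matrix.of fun i j : Fin 1 =>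 if i.val + j.val + 1 = 1 then (1 : L) else 0)).Local v))) : a * b = b * a := by
  rw [Subgroup.mem_centralizer_singleton_iff] at ha hb
  have ha' := (mul_eq_mul_iff_commute_endoEmbLocal L v a γ₀).1 ha
  have hb' := (mul_eq_mul_iff_commute_endoEmbLocal L v b γ₀).1 hb
  exact (mul_eq_mul_iff_commute_endoEmbLocal L v a b).2
    (commute_of_commute_of_isRegularElt_local L v (endoEmbLocal L v γ₀) hγ₀ _ _ ha' hb')

/-- **`Z_H(γ₀) = Z_{U(Φ₂)}(γ₀.1) × U(Φ₁)_v`** (`U(Φ₁)_v` is an abelian direct factor). [cite: Rogawski1990, §3.1 p. 19] -/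
theorem centralizer_eq_prod_top (γ₀ : ((UnitaryGroup.cmDatum L 2 (Matrix.of fun i j : Fin 2 => if i.val + j.val + 1 = 2 then (1 : L) else 0)).Local v × (UnitaryGroup.cmDatum L 1 (Matrix.of fun i j : Fin 1 => if i.val + j.val + 1 = 1 then (1 : L) else 0)).Local v)) :
    Subgroup.centralizer ({γ₀} : Set ((UnitaryGroup.cmDatum L 2 (Matrix.of fun i j : Fin 2 => if i.val + j.val + 1 = 2 then (1 : L) else 0)).Local v × (UnitaryGroup.cmDatum L 1 (Matrix.of fun i j : Fin 1 => if i.val + j.val + 1 = 1 then (1 : L) else 0)).Local v)) = (Subgroup.centralizer ({γ₀.1} : Set ((UnitaryGroup.cmDatum L 2 (Matrix.of fun i j : Fin 2 => if i.val + j.val + 1 = 2 then (1 : L) else 0)).Local v))).prod ⊤ := by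
  ext p
  rw [Subgroup.mem_centralizer_singleton_iff, Subgroup.mem_prod, Subgroup.mem_centralizer_singleton_iff]
  simp only [Subgroup.mem_top, and_true]
  constructor
  · intro h
    exact (Prod.ext_iff.1 h).1
  · intro h
    exact Prod.ext h (mul_comm_cmDatum_local_one L v _ _)

/-- The `U(Φ₂)`-Cartan `Z(γ₀.1)` is compact when `Z_H(γ₀)` is (it is its image under the first projection). [folklore] -/
theorem isCompact_centralizer_fst {γ₀ : ((UnitaryGroup.cmDatum L 2 (Matrix.of fun i j : Fin 2 => if i.val + j.val + 1 = 2 then (1 : L) else 0)).Local v × (UnitaryGroup.cmDatum L 1 (Matrix.of fun i j : Fin 1 => if i.val + j.val + 1 = 1 then (1 : L) else 0)).Local v)} {T : Subgroup ((UnitaryGroup.cmDatum L 2 (Matrix.of fun i j : Fin 2 => if i.val + j.val + 1 = 2 then (1 : L) else 0)).Local v × (UnitaryGroup.cmDatum L 1 (Matrix.of fun i j : Fin 1 => if i.val + j.val + 1 = 1 then (1 : L) else 0)).Local v)} (hT : T = Subgroup.centralizer ({γ₀} : Set ((UnitaryGroup.cmDatum L 2 (Matrix.of fun i j : Fin 2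 => if i.val + j.val + 1 = 2 then (1 : L) else 0)).Local v × (UnitaryGroup.cmDatum L 1 (Matrix.of fun i j : Fin 1 => if i.val + j.val + 1 = 1 then (1 : L) else 0)).Local v))) (hTcpt : IsCompact (T : Set ((UnitaryGroup.cmDatum L 2 (Matrix.of fun i j : Fin 2 => if i.val + j.val + 1 = 2 then (1 : L) else 0)).Local v × (UnitaryGroup.cmDatum L 1 (Matrix.of fun i j : Fin 1 => if i.val + j.val + 1 = 1 then (1 : L) else 0)).Local v))) :
    IsCompact ((Subgroup.centralizer ({γ₀.1} : Set ((UnitaryGroup.cmDatum L 2 (Matrix.of fun i j : Fin 2 => if i.val + j.val + 1 = 2 then (1 : L) else 0)).Local v)) : Subgroup ((UnitaryGroup.cmDatum L 2 (Matrix.of fun i j : Fin 2 => if i.val + j.val + 1 = 2 then (1 : L) else 0)).Local v)) : Set ((UnitaryGroup.cmDatum L 2 (Matrix.of fun i j : Fin 2 => if i.val + j.val + 1 = 2 then (1 : L) else 0)).Local v)) := by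
  have h : ((Subgroup.centralizer ({γ₀.1} : Set ((UnitaryGroup.cmDatum L 2 (Matrix.of fun i j : Fin 2 => if i.val + j.val + 1 = 2 then (1 : L) else 0)).Local v)) : Subgroup ((UnitaryGroup.cmDatum L 2 (Matrix.of fun i j : Fin 2 => if i.val + j.val + 1 = 2 then (1 : L) else 0)).Local v)) : Set ((UnitaryGroup.cmDatum L 2 (Matrix.of fun i j : Fin 2 => if i.val + j.val + 1 = 2 then (1 : L) else 0)).Local v)) = Prod.fst '' (T : Set ((UnitaryGroup.cmDatum L 2 (Matrix.of fun i j : Fin 2 => if i.val + j.val + 1 = 2 then (1 : L) else 0)).Local v × (UnitaryGroup.cmDatum L 1 (Matrix.of fun i j : Fin 1 => if i.val + j.val + 1 = 1 then (1 : L) else 0)).Local v)) := by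
    rw [hT, centralizer_eq_prod_top L v γ₀]
    ext a
    simp only [Subgroup.coe_prod, Subgroup.coe_top, mem_image, mem_prod, mem_univ, and_true, SetLike.mem_coe]
    constructor
    · intro ha; exact ⟨(a, 1), ha, rfl⟩
    · rintro ⟨p, hp, rfl⟩; exact hp
  rw [h]
  exact hTcpt.image continuous_fst

/-- The `U(Φ₂)`-Cartan `Z(γ₀.1)` is abelian for `G`-regular `γ₀` (embed `a ↦ (a, 1)` into `Z_H(γ₀)`). [cite: Rogawski1990, §3.1 p. 19] -/
theorem mul_comm_of_mem_centralizer_fst {γ₀ : ((UnitaryGroup.cmDatum L 2 (Matrix.of fun i j : Fin 2 => if i.val + j.val + 1 = 2 then (1 : L) else 0)).Local v × (UnitaryGroup.cmDatum L 1 (Matrix.of fun i j : Fin 1 => if i.val + j.val + 1 = 1 then (1 : L) else 0)).Local v)} (hγ₀ : IsLocalGRegular L v γ₀)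
    (a : ((UnitaryGroup.cmDatum L 2 (Matrix.of fun i j : Fin 2 => if i.val + j.val + 1 = 2 then (1 : L) else 0)).Local v)) (ha : a ∈ Subgroup.centralizer ({γ₀.1} : Set ((UnitaryGroup.cmDatum L 2 (Matrix.of fun i j : Fin 2 => if i.val + j.val + 1 = 2 then (1 : L) else 0)).Local v))) (b : ((UnitaryGroup.cmDatum L 2 (Matrix.of fun i j : Fin 2 => if i.val + j.val + 1 = 2 then (1 : L) else 0)).Local v)) (hb : b ∈ Subgroup.centralizer ({γ₀.1} : Set ((UnitaryGroup.cmDatum L 2 (Matrix.of fun i j : Fin 2 => if i.val + j.val + 1 = 2 then (1 : L) else 0)).Local v))) : a * b = b * a := by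
  have ha' : ((a, (1 : ((UnitaryGroup.cmDatum L 1 (Matrix.of fun i j : Fin 1 => if i.val + j.val + 1 = 1 then (1 : L) else 0)).Local v))) : ((UnitaryGroup.cmDatum L 2 (Matrix.of fun i j : Fin 2 => if i.val + j.val + 1 = 2 then (1 : L) else 0)).Local v × (UnitaryGroup.cmDatum L 1 (Matrix.of fun i j : Fin 1 => if i.val + j.val + 1 = 1 then (1 : L) else 0)).Local v)) ∈ Subgroup.centralizer ({γ₀} : Set ((UnitaryGroup.cmDatum L 2 (Matrix.of fun i j : Fin 2 => if i.val + j.val + 1 = 2 then (1 : L) else 0)).Local v × (UnitaryGroup.cmDatum L 1 (Matrix.of fun i j : Fin 1 => if i.val + j.val + 1 = 1 then (1 : L) else 0)).Local v)) := by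
    rw [centralizer_eq_prod_top L v γ₀, Subgroup.mem_prod]; exact ⟨ha, Subgroup.mem_top _⟩
  have hb' : ((b, (1 : ((UnitaryGroup.cmDatum L 1 (Matrix.of fun i j : Fin 1 => if i.val + j.val + 1 = 1 then (1 : L) else 0)).Local v))) : ((UnitaryGroup.cmDatum L 2 (Matrix.of fun i j : Fin 2 => if i.val + j.val + 1 = 2 then (1 : L) else 0)).Local v × (UnitaryGroup.cmDatum L 1 (Matrix.of fun i j : Fin 1 => if i.val + j.val + 1 = 1 then (1 : L) else 0)).Local v)) ∈ Subgroup.centralizer ({γ₀} : Set ((UnitaryGroup.cmDatum L 2 (Matrix.of fun i j : Fin 2 => if i.val + j.val + 1 = 2 then (1 : L) else 0)).Local v × (UnitaryGroup.cmDatum L 1 (Matrix.of fun i j : Fin 1 => if i.val + j.val + 1 = 1 then (1 : L) else 0)).Local v)) := by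
    rw [centralizer_eq_prod_top L v γ₀, Subgroup.mem_prod]; exact ⟨hb, Subgroup.mem_top _⟩
  have h := mul_comm_of_mem_centralizer_of_isLocalGRegular L v hγ₀ _ ha' _ hb'
  simpa using (Prod.ext_iff.1 h).1

/-- **The weight `g ↦ √(∏_w |disc χ_g|_w · (∏_w |det g|_w)⁻¹)` is Borel on `U(Φ₂)(L⁺_v)`** (★ `continuous_dgFormulaTwo`, squared). [cite: Rogawski1990, §4.9 p. 54] -/
theorem measurable_sqrt_radicandTwo [MeasurableSpace ((UnitaryGroup.cmDatum L 2 (Matrix.of fun i j : Fin 2 => if i.val + j.val + 1 = 2 then (1 : L) else 0)).Local v)] [BorelSpace ((UnitaryGroup.cmDatum L 2 (Matrix.of fun i j : Fin 2 => if i.val + j.val + 1 = 2 then (1 : L) else 0)).Local v)] :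
    Measurable fun g : ((UnitaryGroup.cmDatum L 2 (Matrix.of fun i j : Fin 2 => if i.val + j.val + 1 = 2 then (1 : L) else 0)).Local v) => NNReal.sqrt ((∏ w : PlacesOver L v, Literature.NumberTheory.GaloisRepresentations.IsNonarchimedeanLocalField.normAbs (w.1.adicCompletion L) (((g.val : GL (Fin 2) (UnitaryGroup.LocalRing L v)).val.charpoly.discr) w)) * (∏ w : PlacesOver L v, Literature.NumberTheory.GaloisRepresentations.IsNonarchimedeanLocalField.normAbs (w.1.adicCompletion L) (((g.val : GL (Fin 2) (UnitaryGroup.LocalRing L v)).val.det) w))⁻¹) := by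
  have h : Continuous fun g : ((UnitaryGroup.cmDatum L 2 (Matrix.of fun i j : Fin 2 => if i.val + j.val + 1 = 2 then (1 : L) else 0)).Local v) => NNReal.sqrt (NNReal.sqrt ((∏ w : PlacesOver L v, Literature.NumberTheory.GaloisRepresentations.IsNonarchimedeanLocalField.normAbs (w.1.adicCompletion L) (((g.val : GL (Fin 2) (UnitaryGroup.LocalRing L v)).val.charpoly.discr) w)) * (∏ w : PlacesOver L v, Literature.NumberTheory.GaloisRepresentations.IsNonarchimedeanLocalField.normAbs (w.1.adicCompletion L) (((g.val : GL (Fin 2) (UnitaryGroup.LocalRing L v)).val.det) w))⁻¹)) :=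
    continuous_induced_rng.2 (F0P3cStCharTSDGFieldTwo.continuous_dgFormulaTwo L v (Matrix.of fun i j : Fin 2 => if i.val + j.val + 1 = 2 then (1 : L) else 0))
  have h2 : Measurable fun g : ((UnitaryGroup.cmDatum L 2 (Matrix.of fun i j : Fin 2 => if i.val + j.val + 1 = 2 then (1 : L) else 0)).Local v) => (NNReal.sqrt (NNReal.sqrt ((∏ w : PlacesOver L v, Literature.NumberTheory.GaloisRepresentations.IsNonarchimedeanLocalField.normAbs (w.1.adicCompletion L) (((g.val : GL (Fin 2) (UnitaryGroup.LocalRing L v)).val.charpoly.discr) w)) * (∏ w : PlacesOver L v, Literature.NumberTheory.GaloisRepresentations.IsNonarchimedeanLocalField.normAbs (w.1.adicCompletion L) (((g.val : GL (Fin 2) (UnitaryGroup.LocalRing L v)).val.det) w))⁻¹))) ^ 2 := h.measurable.pow_const 2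
  have h3 : (fun g : ((UnitaryGroup.cmDatum L 2 (Matrix.of fun i j : Fin 2 => if i.val + j.val + 1 = 2 then (1 : L) else 0)).Local v) => (NNReal.sqrt (NNReal.sqrt ((∏ w : PlacesOver L v, Literature.NumberTheory.GaloisRepresentations.IsNonarchimedeanLocalField.normAbs (w.1.adicCompletion L) (((g.val : GL (Fin 2) (UnitaryGroup.LocalRing L v)).val.charpoly.discr) w)) * (∏ w : PlacesOver L v, Literature.NumberTheory.GaloisRepresentations.IsNonarchimedeanLocalField.normAbs (w.1.adicCompletion L) (((g.val : GL (Fin 2) (UnitaryGroup.LocalRing L v)).val.det) w))⁻¹))) ^ 2) = fun g : ((UnitaryGroup.cmDatum L 2 (Matrix.of fun i j : Fin 2 => if i.val + j.val + 1 = 2 then (1 : L) else 0)).Local v) => NNReal.sqrt ((∏ w : PlacesOver L v, Literature.NumberTheory.GaloisRepresentations.IsNonarchimedeanLocalField.normAbs (w.1.adicCompletion L) (((g.val : GL (Fin 2) (UnitaryGroup.LocalRing L v)).val.charpoly.discr) w)) * (∏ w : PlacesOver L v, Literature.NumberTheory.GaloisRepresentations.IsNonarchimedeanLocalField.normAbs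 (w.1.adicCompletion L) (((g.val : GL (Fin 2) (UnitaryGroup.LocalRing L v)).val.det) w))⁻¹) :=
    funext fun g => NNReal.sq_sqrt _
  rw [h3] at h2
  exact h2

/-! ## §2 The (H4c) terminus modulo the `N = 2` dock -/

set_option maxHeartbeats 1600000 in
set_option synthInstance.maxHeartbeats 400000 in
-- long socket statement on the CM product carrier (class of ★ C8 TERMINUS ∕ ★ (E4))
/-- **(H4c) «JAC-H-CPT» MODULO THE `N = 2` DOCK.**  `H_v = U(Φ₂)_v × U(Φ₁)_v`, `v` non-split (`hns`), `ν` a Haar measure on `H_v`.  HYPOTHESIS `hDock` = the local tube-Jacobian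
socket on `U(Φ₂)_v` at every COMPACT Cartan `Z(g₀)` (`g₀` regular in `GL₂`) for ALL Haar data, weight `√(∏|disc|·(∏|det|)⁻¹)` — the conclusion of (H4c-1) `tubeJacobianLocal_cartan_((UnitaryGroup.cmDatum L 2 (Matrix.of fun i j : Fin 2 => if i.val + j.val + 1 = 2 then (1 : L) else 0)).Local v)_elliptic`
(LH6-p04 (g7)) at the Borel σ-algebras.  CONCLUSION = the (H4c) letters (LH5-p02 (g7), 1d8f2a85746fa380) token for token: for every compact `T = Z_H(γ₀)` (`γ₀` `G`-regular), every Haar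
`tT` on `T` with inversion symmetry and `tT (compactCore T) = 1`, every `G`-regular `t₀ ∈ T` has an open `U ∋ t₀` and a Borel `A₀ ⊆ H_v ⧸ T` with `0 < (ν∕tT)(A₀) < ∞` such that for all Borel,
`G`-regular, `W`-free `V ⊆ U`: `ν {x t x⁻¹ | x̄ ∈ A₀, t ∈ V} = (ν∕tT)(A₀) · ∫⁻_V √(∏_w |disc χ_{t.1}|_w (∏_w |det t.1|_w)⁻¹) dtT`.  PROOF: (H4c-2) ★ `tubeJacobianLocal_prod_compact` at
`G₂ = U(Φ₂)_v`, `K = U(Φ₁)_v` (compact ★, abelian §1), `T₂ = Z(γ₀.1)` (compact, abelian §1), `R = IsLocalGRegular`, `R₂ = IsRegularElt` (§1), the tube identity `Φ '' (A₀ ×ˢ V) = {…}`.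
[cite: HarishChandra1970, Lemma 22] [cite: Rogawski1990, §12.5 pp. 182–183; §4.9 p. 54] -/
theorem tubeJacobianSocket_compactCartan_H_of_dock
    (hns : ∀ w : PlacesOver L v, IsCMField.complexConj L • w.1 = w.1)
    (hDock : ∀ [MeasurableSpace ((UnitaryGroup.cmDatum L 2 (Matrix.of fun i j : Fin 2 => if i.val + j.val + 1 = 2 then (1 : L) else 0)).Local v)] [BorelSpace ((UnitaryGroup.cmDatum L 2 (Matrix.of fun i j : Fin 2 => if i.val + j.val + 1 = 2 then (1 : L) else 0)).Local v)]
      {T₂ : Subgroup ((UnitaryGroup.cmDatum L 2 (Matrix.of fun i j : Fin 2 => if i.val + j.val + 1 = 2 then (1 : L) else 0)).Local v)} {g₀ : ((UnitaryGroup.cmDatum L 2 (Matrix.of fun i j : Fin 2 => if i.val + j.val + 1 = 2 then (1 : L) else 0)).Local v)} (_ : T₂ = Subgroup.centralizer ({g₀} : Set ((UnitaryGroup.cmDatum L 2 (Matrix.of fun i j : Fin 2 => if i.val + j.val + 1 = 2 then (1 : L) else 0)).Local v)))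
      (_ : IsRegularElt (g₀.val : GL (Fin 2) (UnitaryGroup.LocalRing L v))) (hT₂cpt : IsCompact (T₂ : Set ((UnitaryGroup.cmDatum L 2 (Matrix.of fun i j : Fin 2 => if i.val + j.val + 1 = 2 then (1 : L) else 0)).Local v)))
      (Φ₂ : (((UnitaryGroup.cmDatum L 2 (Matrix.of fun i j : Fin 2 => if i.val + j.val + 1 = 2 then (1 : L) else 0)).Local v) ⧸ T₂) × ↥T₂ → ((UnitaryGroup.cmDatum L 2 (Matrix.of fun i j : Fin 2 => if i.val + j.val + 1 = 2 then (1 : L) else 0)).Local v)) (_ : ∀ (x : ((UnitaryGroup.cmDatum L 2 (Matrix.of fun i j : Fin 2 => if i.val + j.val + 1 = 2 then (1 : L) else 0)).Local v)) (t : ↥T₂), Φ₂ (QuotientGroup.mk x, t) = x * t * x⁻¹)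
      [MeasurableSpace (((UnitaryGroup.cmDatum L 2 (Matrix.of fun i j : Fin 2 => if i.val + j.val + 1 = 2 then (1 : L) else 0)).Local v) ⧸ T₂)] [BorelSpace (((UnitaryGroup.cmDatum L 2 (Matrix.of fun i j : Fin 2 => if i.val + j.val + 1 = 2 then (1 : L) else 0)).Local v) ⧸ T₂)]
      (ν₂ : Measure ((UnitaryGroup.cmDatum L 2 (Matrix.of fun i j : Fin 2 => if i.val + j.val + 1 = 2 then (1 : L) else 0)).Local v)) [ν₂.IsHaarMeasure] [ν₂.IsMulRightInvariant]
      (tm₂ : Measure ↥T₂) [tm₂.IsMulLeftInvariant] [IsFiniteMeasureOnCompacts tm₂] [tm₂.IsOpenPosMeasure] [tm₂.IsInvInvariant],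
      ∀ t₀ : ↥T₂, IsRegularElt (((t₀ : ((UnitaryGroup.cmDatum L 2 (Matrix.of fun i j : Fin 2 => if i.val + j.val + 1 = 2 then (1 : L) else 0)).Local v))).val : GL (Fin 2) (UnitaryGroup.LocalRing L v)) →
        ∃ U : Set ↥T₂, IsOpen U ∧ t₀ ∈ U ∧
          ∃ A₀ : Set (((UnitaryGroup.cmDatum L 2 (Matrix.of fun i j : Fin 2 => if i.val + j.val + 1 = 2 then (1 : L) else 0)).Local v) ⧸ T₂), MeasurableSet A₀ ∧ quotientMeasure T₂ tm₂ hT₂cpt.isClosed ν₂ A₀ ≠ 0 ∧ quotientMeasure T₂ tm₂ hT₂cpt.isClosed ν₂ A₀ ≠ ∞ ∧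
            ∀ V : Set ↥T₂, MeasurableSet V → V ⊆ U → (∀ t ∈ V, IsRegularElt (((t : ((UnitaryGroup.cmDatum L 2 (Matrix.of fun i j : Fin 2 => if i.val + j.val + 1 = 2 then (1 : L) else 0)).Local v))).val : GL (Fin 2) (UnitaryGroup.LocalRing L v))) →
              (∀ n : ((UnitaryGroup.cmDatum L 2 (Matrix.of fun i j : Fin 2 => if i.val + j.val + 1 = 2 then (1 : L) else 0)).Local v), n ∉ T₂ → ∀ t ∈ V, ∀ t' ∈ V, ((t' : ↥T₂) : ((UnitaryGroup.cmDatum L 2 (Matrix.of fun i j : Fin 2 => if i.val + j.val + 1 = 2 then (1 : L) else 0)).Local v)) ≠ n * t * n⁻¹) →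
                ν₂ (Φ₂ '' (A₀ ×ˢ V)) = quotientMeasure T₂ tm₂ hT₂cpt.isClosed ν₂ A₀ *
                  ∫⁻ t in V, ((NNReal.sqrt ((∏ w : PlacesOver L v, Literature.NumberTheory.GaloisRepresentations.IsNonarchimedeanLocalField.normAbs (w.1.adicCompletion L) (((((t : ((UnitaryGroup.cmDatum L 2 (Matrix.of fun i j : Fin 2 => if i.val + j.val + 1 = 2 then (1 : L) else 0)).Local v))).val : GL (Fin 2) (UnitaryGroup.LocalRing L v)).val.charpoly.discr) w)) * (∏ w : PlacesOver L v, Literature.NumberTheory.GaloisRepresentations.IsNonarchimedeanLocalField.normAbs (w.1.adicCompletion L) (((((t : ((UnitaryGroup.cmDatum L 2 (Matrix.of fun i j : Fin 2 => if i.val + j.val + 1 = 2 then (1 : L) else 0)).Local v))).val : GL (Fin 2) (UnitaryGroup.LocalRing L v)).val.det) w))⁻¹) : ℝ≥0) : ℝ≥0∞) ∂tm₂)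
    [instM : MeasurableSpace ((UnitaryGroup.cmDatum L 2 (Matrix.of fun i j : Fin 2 => if i.val + j.val + 1 = 2 then (1 : L) else 0)).Local v × (UnitaryGroup.cmDatum L 1 (Matrix.of fun i j : Fin 1 => if i.val + j.val + 1 = 1 then (1 : L) else 0)).Local v)] [instB : BorelSpace ((UnitaryGroup.cmDatum L 2 (Matrix.of fun i j : Fin 2 => if i.val + j.val + 1 = 2 then (1 : L) else 0)).Local v × (UnitaryGroup.cmDatum L 1 (Matrix.of fun i j : Fin 1 => if i.val + j.val + 1 = 1 then (1 : L) else 0)).Local v)] [LocallyCompactSpace ((UnitaryGroup.cmDatum L 2 (Matrix.of fun i j : Fin 2 => if i.val + j.val + 1 = 2 then (1 : L) else 0)).Local v × (UnitaryGroup.cmDatum L 1 (Matrix.of fun i j : Fin 1 => if i.val + j.val + 1 = 1 then (1 : L) else 0)).Local v)] [SecondCountableTopology ((UnitaryGroup.cmDatum L 2 (Matrix.of fun i j : Fin 2 => if i.val + j.val + 1 = 2 then (1 : L) else 0)).Local v × (UnitaryGroup.cmDatum L 1 (Matrix.of fun i j : Fin 1 => if i.val + j.val + 1 = 1 then (1 :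 L) else 0)).Local v)] [T2Space ((UnitaryGroup.cmDatum L 2 (Matrix.of fun i j : Fin 2 => if i.val + j.val + 1 = 2 then (1 : L) else 0)).Local v × (UnitaryGroup.cmDatum L 1 (Matrix.of fun i j : Fin 1 => if i.val + j.val + 1 = 1 then (1 : L) else 0)).Local v)]
    (ν : Measure ((UnitaryGroup.cmDatum L 2 (Matrix.of fun i j : Fin 2 => if i.val + j.val + 1 = 2 then (1 : L) else 0)).Local v × (UnitaryGroup.cmDatum L 1 (Matrix.of fun i j : Fin 1 => if i.val + j.val + 1 = 1 then (1 : L) else 0)).Local v)) [ν.IsHaarMeasure] [ν.IsMulRightInvariant] :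
    ∀ (T : Subgroup ((UnitaryGroup.cmDatum L 2 (Matrix.of fun i j : Fin 2 => if i.val + j.val + 1 = 2 then (1 : L) else 0)).Local v × (UnitaryGroup.cmDatum L 1 (Matrix.of fun i j : Fin 1 => if i.val + j.val + 1 = 1 then (1 : L) else 0)).Local v)) (γ₀ : ((UnitaryGroup.cmDatum L 2 (Matrix.of fun i j : Fin 2 => if i.val + j.val + 1 = 2 then (1 : L) else 0)).Local v × (UnitaryGroup.cmDatum L 1 (Matrix.of fun i j : Fin 1 => if i.val + j.val + 1 = 1 then (1 : L) else 0)).Local v)) (_ : IsLocalGRegular L v γ₀) (_ : T = Subgroup.centralizer ({γ₀} : Set ((UnitaryGroup.cmDatum L 2 (Matrix.of fun i j : Fin 2 => if i.val + j.val + 1 = 2 then (1 : L) else 0)).Local v × (UnitaryGroup.cmDatum L 1 (Matrix.of fun i j : Fin 1 => if i.val + j.val + 1 = 1 then (1 : L) else 0)).Local v))) (hTcpt : IsCompact (T : Set ((UnitaryGroup.cmDatum L 2 (Matrix.of fun i j : Fin 2 => if i.val + j.val + 1 = 2 then (1 : L) else 0)).Local v × (UnitaryGroup.cmDatum L 1 (Matrix.of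 fun i j : Fin 1 => if i.val + j.val + 1 = 1 then (1 : L) else 0)).Local v))),
      (letI : MeasurableSpace (((UnitaryGroup.cmDatum L 2 (Matrix.of fun i j : Fin 2 => if i.val + j.val + 1 = 2 then (1 : L) else 0)).Local v × (UnitaryGroup.cmDatum L 1 (Matrix.of fun i j : Fin 1 => if i.val + j.val + 1 = 1 then (1 : L) else 0)).Local v) ⧸ T) := borel _
      haveI : BorelSpace (((UnitaryGroup.cmDatum L 2 (Matrix.of fun i j : Fin 2 => if i.val + j.val + 1 = 2 then (1 : L) else 0)).Local v × (UnitaryGroup.cmDatum L 1 (Matrix.of fun i j : Fin 1 => if i.val + j.val + 1 = 1 then (1 : L) else 0)).Local v) ⧸ T) := ⟨rfl⟩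
      ∀ (tT : Measure ↥T) (_ : tT.IsHaarMeasure) (_ : tT.IsInvInvariant), tT (compactCore ↥T) = 1 →
        ∀ t₀ : ↥T, IsLocalGRegular L v (t₀ : ((UnitaryGroup.cmDatum L 2 (Matrix.of fun i j : Fin 2 => if i.val + j.val + 1 = 2 then (1 : L) else 0)).Local v × (UnitaryGroup.cmDatum L 1 (Matrix.of fun i j : Fin 1 => if i.val + j.val + 1 = 1 then (1 : L) else 0)).Local v)) →
        ∃ U : Set ↥T, IsOpen U ∧ t₀ ∈ U ∧
        ∃ A₀ : Set (((UnitaryGroup.cmDatum L 2 (Matrix.of fun i j : Fin 2 => if i.val + j.val + 1 = 2 then (1 : L) else 0)).Local v × (UnitaryGroup.cmDatum L 1 (Matrix.of fun i j : Fin 1 => if i.val + j.val + 1 = 1 then (1 : L) else 0)).Local v) ⧸ T), MeasurableSet A₀ ∧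
          quotientMeasure T tT hTcpt.isClosed ν A₀ ≠ 0 ∧ quotientMeasure T tT hTcpt.isClosed ν A₀ ≠ ∞ ∧
          ∀ V : Set ↥T, MeasurableSet V → V ⊆ U →
            (∀ t ∈ V, IsLocalGRegular L v (t : ((UnitaryGroup.cmDatum L 2 (Matrix.of fun i j : Fin 2 => if i.val + j.val + 1 = 2 then (1 : L) else 0)).Local v × (UnitaryGroup.cmDatum L 1 (Matrix.of fun i j : Fin 1 => if i.val + j.val + 1 = 1 then (1 : L) else 0)).Local v))) →
            (∀ n : ((UnitaryGroup.cmDatum L 2 (Matrix.of fun i j : Fin 2 => if i.val + j.val + 1 = 2 then (1 : L) else 0)).Local v × (UnitaryGroup.cmDatum L 1 (Matrix.of fun i j : Fin 1 => if i.val + j.val + 1 = 1 then (1 : L) else 0)).Local v), n ∉ T → ∀ t ∈ V, ∀ t' ∈ V, ((t' : ↥T) : ((UnitaryGroup.cmDatum L 2 (Matrix.of fun i j : Fin 2 => if i.val + j.val + 1 = 2 then (1 : L) else 0)).Local v × (UnitaryGroup.cmDatum L 1 (Matrix.of fun i j : Fin 1 => if i.val + j.val + 1 = 1 then (1 : L)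 else 0)).Local v)) ≠ n * t * n⁻¹) →
              ν {y : ((UnitaryGroup.cmDatum L 2 (Matrix.of fun i j : Fin 2 => if i.val + j.val + 1 = 2 then (1 : L) else 0)).Local v × (UnitaryGroup.cmDatum L 1 (Matrix.of fun i j : Fin 1 => if i.val + j.val + 1 = 1 then (1 : L) else 0)).Local v) | ∃ (x : ((UnitaryGroup.cmDatum L 2 (Matrix.of fun i j : Fin 2 => if i.val + j.val + 1 = 2 then (1 : L) else 0)).Local v × (UnitaryGroup.cmDatum L 1 (Matrix.of fun i j : Fin 1 => if i.val + j.val + 1 = 1 then (1 : L) else 0)).Local v)) (t : ↥T), (QuotientGroup.mk x : ((UnitaryGroup.cmDatum L 2 (Matrix.of fun i j : Fin 2 => if i.val + j.val + 1 = 2 then (1 : L) else 0)).Local v × (UnitaryGroup.cmDatum L 1 (Matrix.of fun i j : Fin 1 => if i.val + j.val + 1 = 1 then (1 : L) else 0)).Local v) ⧸ T) ∈ A₀ ∧ t ∈ V ∧ y = x * t * x⁻¹} =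
                quotientMeasure T tT hTcpt.isClosed ν A₀ *
                  ∫⁻ t in V, ((NNReal.sqrt ((∏ w : PlacesOver L v, Literature.NumberTheory.GaloisRepresentations.IsNonarchimedeanLocalField.normAbs (w.1.adicCompletion L) (((((t : ((UnitaryGroup.cmDatum L 2 (Matrix.of fun i j : Fin 2 => if i.val + j.val + 1 = 2 then (1 : L) else 0)).Local v × (UnitaryGroup.cmDatum L 1 (Matrix.of fun i j : Fin 1 => if i.val + j.val + 1 = 1 then (1 : L) else 0)).Local v)).1.val : GL (Fin 2) (UnitaryGroup.LocalRing L v))).val.charpoly.discr) w)) * (∏ w : PlacesOver L v, Literature.NumberTheory.GaloisRepresentations.IsNonarchimedeanLocalField.normAbs (w.1.adicCompletion L) (((((t : ((UnitaryGroup.cmDatum L 2 (Matrix.of fun i j : Fin 2 => if i.val + j.val + 1 = 2 then (1 : L) else 0)).Local v × (UnitaryGroup.cmDatum L 1 (Matrix.of fun i j : Fin 1 => if i.val + j.val + 1 = 1 then (1 : L) else 0)).Local v)).1.val : GL (Fin 2) (UnitaryGroup.LocalRing L v))).val.det) w))⁻¹) : ℝ≥0) : ℝ≥0∞) ∂tT)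 := by
  intro T γ₀ hγ₀ hT hTcpt
  letI : MeasurableSpace (((UnitaryGroup.cmDatum L 2 (Matrix.of fun i j : Fin 2 => if i.val + j.val + 1 = 2 then (1 : L) else 0)).Local v × (UnitaryGroup.cmDatum L 1 (Matrix.of fun i j : Fin 1 => if i.val + j.val + 1 = 1 then (1 : L) else 0)).Local v) ⧸ T) := borel _
  haveI : BorelSpace (((UnitaryGroup.cmDatum L 2 (Matrix.of fun i j : Fin 2 => if i.val + j.val + 1 = 2 then (1 : L) else 0)).Local v × (UnitaryGroup.cmDatum L 1 (Matrix.of fun i j : Fin 1 => if i.val + j.val + 1 = 1 then (1 : L) else 0)).Local v) ⧸ T) := ⟨rfl⟩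
  intro tT _ _ _ t₀ ht₀
  classical
  /- ### Borel structures on the factors; the product structure IS the given one -/
  letI mTwo : MeasurableSpace ((UnitaryGroup.cmDatum L 2 (Matrix.of fun i j : Fin 2 => if i.val + j.val + 1 = 2 then (1 : L) else 0)).Local v) := borel _
  haveI bTwo : BorelSpace ((UnitaryGroup.cmDatum L 2 (Matrix.of fun i j : Fin 2 => if i.val + j.val + 1 = 2 then (1 : L) else 0)).Local v) := ⟨rfl⟩
  letI mOne : MeasurableSpace ((UnitaryGroup.cmDatum L 1 (Matrix.of fun i j : Fin 1 => if i.val + j.val + 1 = 1 then (1 : L) else 0)).Local v) := borel _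
  haveI bOne : BorelSpace ((UnitaryGroup.cmDatum L 1 (Matrix.of fun i j : Fin 1 => if i.val + j.val + 1 = 1 then (1 : L) else 0)).Local v) := ⟨rfl⟩
  have hinst : instM = Prod.instMeasurableSpace := by
    rw [instB.measurable_eq]
    exact (Prod.borelSpace (α := ((UnitaryGroup.cmDatum L 2 (Matrix.of fun i j : Fin 2 => if i.val + j.val + 1 = 2 then (1 : L) else 0)).Local v)) (β := ((UnitaryGroup.cmDatum L 1 (Matrix.of fun i j : Fin 1 => if i.val + j.val + 1 = 1 then (1 : L) else 0)).Local v))).measurable_eq.symm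
  subst hinst
  /- ### the place `w ∣ v`, compactness of `U(Φ₁)_v`, the abelian data -/
  obtain ⟨w⟩ := (inferInstance : Nonempty (PlacesOver L v))
  haveI : CompactSpace ((UnitaryGroup.cmDatum L 1 (Matrix.of fun i j : Fin 1 => if i.val + j.val + 1 = 1 then (1 : L) else 0)).Local v) := compactSpace_cmDatum_local_one_of_smul_eq L v w (hns w)
  have hK : ∀ a b : ((UnitaryGroup.cmDatum L 1 (Matrix.of fun i j : Fin 1 => if i.val + j.val + 1 = 1 then (1 : L) else 0)).Local v), a * b = b * a := mul_comm_cmDatum_local_one L v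
  have hreg₁ : IsRegularElt (γ₀.1.val : GL (Fin 2) (UnitaryGroup.LocalRing L v)) := isRegularElt_fst_of_isLocalGRegular L v hγ₀
  have hab₂ := mul_comm_of_mem_centralizer_fst L v hγ₀
  have habT : ∀ a ∈ T, ∀ b ∈ T, a * b = b * a := by
    rw [hT]; exact mul_comm_of_mem_centralizer_of_isLocalGRegular L v hγ₀
  have hT₂cpt := isCompact_centralizer_fst L v hT hTcpt
  have hT' : T = (Subgroup.centralizer ({γ₀.1} : Set ((UnitaryGroup.cmDatum L 2 (Matrix.of fun i j : Fin 2 => if i.val + j.val + 1 = 2 then (1 : L) else 0)).Local v))).prod ⊤ := by rw [hT, centralizer_eq_prod_top L v γ₀]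
  /- ### conjugation families -/
  obtain ⟨Φ₂, hΦ₂⟩ := exists_conjFamily (Subgroup.centralizer ({γ₀.1} : Set ((UnitaryGroup.cmDatum L 2 (Matrix.of fun i j : Fin 2 => if i.val + j.val + 1 = 2 then (1 : L) else 0)).Local v))) hab₂
  obtain ⟨Φ, hΦ⟩ := exists_conjFamily T habT
  letI : MeasurableSpace (((UnitaryGroup.cmDatum L 2 (Matrix.of fun i j : Fin 2 => if i.val + j.val + 1 = 2 then (1 : L) else 0)).Local v) ⧸ Subgroup.centralizer ({γ₀.1} : Set ((UnitaryGroup.cmDatum L 2 (Matrix.of fun i j : Fin 2 => if i.val + j.val + 1 = 2 then (1 : L) else 0)).Local v))) := borel _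
  haveI : BorelSpace (((UnitaryGroup.cmDatum L 2 (Matrix.of fun i j : Fin 2 => if i.val + j.val + 1 = 2 then (1 : L) else 0)).Local v) ⧸ Subgroup.centralizer ({γ₀.1} : Set ((UnitaryGroup.cmDatum L 2 (Matrix.of fun i j : Fin 2 => if i.val + j.val + 1 = 2 then (1 : L) else 0)).Local v))) := ⟨rfl⟩
  /- ### the generic product theorem -/
  obtain ⟨U, hUo, ht₀U, A₀, hA₀m, hA₀0, hA₀top, hJ⟩ :=
    tubeJacobianLocal_prod_compact (G₂ := ((UnitaryGroup.cmDatum L 2 (Matrix.of fun i j : Fin 2 => if i.val + j.val + 1 = 2 then (1 : L) else 0)).Local v)) (K := ((UnitaryGroup.cmDatum L 1 (Matrix.of fun i j : Fin 1 => if i.val + j.val + 1 = 1 then (1 : L) else 0)).Local v)) hT₂cpt hab₂ hK Φ₂ hΦ₂ hT₂cpt.isClosed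
      (fun g : ((UnitaryGroup.cmDatum L 2 (Matrix.of fun i j : Fin 2 => if i.val + j.val + 1 = 2 then (1 : L) else 0)).Local v) => IsRegularElt (g.val : GL (Fin 2) (UnitaryGroup.LocalRing L v)))
      (fun g : ((UnitaryGroup.cmDatum L 2 (Matrix.of fun i j : Fin 2 => if i.val + j.val + 1 = 2 then (1 : L) else 0)).Local v) => NNReal.sqrt ((∏ w : PlacesOver L v, Literature.NumberTheory.GaloisRepresentations.IsNonarchimedeanLocalField.normAbs (w.1.adicCompletion L) (((g.val : GL (Fin 2) (UnitaryGroup.LocalRing L v)).val.charpoly.discr) w)) * (∏ w : PlacesOver L v, Literature.NumberTheory.GaloisRepresentations.IsNonarchimedeanLocalField.normAbs (w.1.adicCompletion L) (((g.val : GL (Fin 2) (UnitaryGroup.LocalRing L v)).val.det) w))⁻¹))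
      (measurable_sqrt_radicandTwo L v)
      (fun ν₂ _ _ tm₂ _ _ _ _ => hDock rfl hreg₁ hT₂cpt Φ₂ hΦ₂ ν₂ tm₂)
      hT' hTcpt.isClosed Φ hΦ ν tT (IsLocalGRegular L v) (fun p hp => isRegularElt_fst_of_isLocalGRegular L v hp)
      (fun t : ↥T => NNReal.sqrt ((∏ w : PlacesOver L v, Literature.NumberTheory.GaloisRepresentations.IsNonarchimedeanLocalField.normAbs (w.1.adicCompletion L) (((((t : ((UnitaryGroup.cmDatum L 2 (Matrix.of fun i j : Fin 2 => if i.val + j.val + 1 = 2 then (1 : L) else 0)).Local v × (UnitaryGroup.cmDatum L 1 (Matrix.of fun i j : Fin 1 => if i.val + j.val + 1 = 1 then (1 : L) else 0)).Local v)).1.val : GL (Fin 2) (UnitaryGroup.LocalRing L v))).val.charpoly.discr) w)) * (∏ w : PlacesOver L v, Literature.NumberTheory.GaloisRepresentations.IsNonarchimedeanLocalField.normAbs (w.1.adicCompletion L) (((((t : ((UnitaryGroup.cmDatum L 2 (Matrix.of fun i j : Fin 2 => if i.val + j.val + 1 = 2 then (1 : L) else 0)).Local v × (UnitaryGroup.cmDatum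 L 1 (Matrix.of fun i j : Fin 1 => if i.val + j.val + 1 = 1 then (1 : L) else 0)).Local v)).1.val : GL (Fin 2) (UnitaryGroup.LocalRing L v))).val.det) w))⁻¹)) (fun _ => rfl) t₀ ht₀
  refine ⟨U, hUo, ht₀U, A₀, hA₀m, hA₀0, hA₀top, fun V hVm hVU hVreg hVW => ?_⟩
  /- ### the tube IS `Φ '' (A₀ ×ˢ V)` -/
  have htube : {y : ((UnitaryGroup.cmDatum L 2 (Matrix.of fun i j : Fin 2 => if i.val + j.val + 1 = 2 then (1 : L) else 0)).Local v × (UnitaryGroup.cmDatum L 1 (Matrix.of fun i j : Fin 1 => if i.val + j.val + 1 = 1 then (1 : L) else 0)).Local v) | ∃ (x : ((UnitaryGroup.cmDatum L 2 (Matrix.of fun i j : Fin 2 => if i.val + j.val + 1 = 2 then (1 : L) else 0)).Local v × (UnitaryGroup.cmDatum L 1 (Matrix.of fun i j : Fin 1 => if i.val + j.val + 1 = 1 then (1 : L) else 0)).Local v)) (t : ↥T), (QuotientGroup.mk x : ((UnitaryGroup.cmDatum L 2 (Matrix.of fun i j : Fin 2 => if i.val + j.val + 1 = 2 then (1 : L)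 else 0)).Local v × (UnitaryGroup.cmDatum L 1 (Matrix.of fun i j : Fin 1 => if i.val + j.val + 1 = 1 then (1 : L) else 0)).Local v) ⧸ T) ∈ A₀ ∧ t ∈ V ∧ y = x * t * x⁻¹} = Φ '' (A₀ ×ˢ V) := by
    ext y
    constructor
    · rintro ⟨x, t, hx, ht, rfl⟩
      exact ⟨(QuotientGroup.mk x, t), ⟨hx, ht⟩, hΦ x t⟩
    · rintro ⟨⟨q, t⟩, ⟨hq, ht⟩, rfl⟩
      obtain ⟨x, rfl⟩ := QuotientGroup.mk_surjective q
      exact ⟨x, t, hq, ht, hΦ x t⟩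
  rw [htube]
  exact hJ V hVm hVU hVreg hVW

/-! ## §3 The (H4c) terminus, unconditional -/

set_option maxHeartbeats 1600000 in
set_option synthInstance.maxHeartbeats 400000 in
-- long socket statement on the CM product carrier (class of ★ C8 TERMINUS ∕ ★ (E4))
/-- **(H4c) «JAC-H-CPT» — THE COMPACT-CARTAN TUBE-JACOBIAN SOCKET ON `H_v = U(Φ₂)(L⁺_v) × U(Φ₁)(L⁺_v)`, IN THE SIGNED LETTERS** (LH5-p02 (g7), sigsheet 1d8f2a85746fa380,
token for token): `v` non-split (`hns`), `ν` a Haar measure on `H_v`; for every subgroup `T = Z_H(γ₀)` with `γ₀` `G`-regular and `T` COMPACT, every Haar measure `tT` of `T` with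
inversion symmetry and `tT (compactCore T) = 1` (Borel σ-algebra on `H_v ⧸ T`): every `G`-regular `t₀ ∈ T` has an open `U ∋ t₀` and a Borel `A₀ ⊆ H_v ⧸ T` with `0 < (ν∕tT)(A₀) < ∞` such
that for all Borel, `G`-regular, `W`-free `V ⊆ U`, `ν {x t x⁻¹ | x̄ ∈ A₀, t ∈ V} = (ν∕tT)(A₀) · ∫⁻_V √(∏_w |disc χ_{t.1}|_w (∏_w |det t.1|_w)⁻¹) dtT`.  PROOF: §2 with `hDock` := ★ (H4c-1)
`tubeJacobianLocal_cartan_U2_elliptic` at the place `w ∣ v` fixed by `c̄` (`hns`). [cite: HarishChandra1970, Lemma 22] [cite: Rogawski1990, §12.5 pp. 182–183; §4.9 p. 54] -/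
theorem tubeJacobianSocket_compactCartan_H
    (hns : ∀ w : PlacesOver L v, IsCMField.complexConj L • w.1 = w.1)
    [MeasurableSpace ((UnitaryGroup.cmDatum L 2 (Matrix.of fun i j : Fin 2 => if i.val + j.val + 1 = 2 then (1 : L) else 0)).Local v × (UnitaryGroup.cmDatum L 1 (Matrix.of fun i j : Fin 1 => if i.val + j.val + 1 = 1 then (1 : L) else 0)).Local v)] [BorelSpace ((UnitaryGroup.cmDatum L 2 (Matrix.of fun i j : Fin 2 => if i.val + j.val + 1 = 2 then (1 : L) else 0)).Local v × (UnitaryGroup.cmDatum L 1 (Matrix.of fun i j : Fin 1 => if i.val + j.val + 1 = 1 then (1 : L) else 0)).Local v)] [LocallyCompactSpace ((UnitaryGroup.cmDatum L 2 (Matrix.of fun i j : Fin 2 => if i.val + j.val + 1 = 2 then (1 : L) else 0)).Local v × (UnitaryGroup.cmDatum L 1 (Matrix.of fun i j : Fin 1 => if i.val + j.val + 1 = 1 then (1 : L) else 0)).Local v)] [SecondCountableTopology ((UnitaryGroup.cmDatum L 2 (Matrix.of fun i j : Fin 2 => if i.val + j.val + 1 = 2 then (1 : L) else 0)).Local v ×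 (UnitaryGroup.cmDatum L 1 (Matrix.of fun i j : Fin 1 => if i.val + j.val + 1 = 1 then (1 : L) else 0)).Local v)] [T2Space ((UnitaryGroup.cmDatum L 2 (Matrix.of fun i j : Fin 2 => if i.val + j.val + 1 = 2 then (1 : L) else 0)).Local v × (UnitaryGroup.cmDatum L 1 (Matrix.of fun i j : Fin 1 => if i.val + j.val + 1 = 1 then (1 : L) else 0)).Local v)]
    (ν : Measure ((UnitaryGroup.cmDatum L 2 (Matrix.of fun i j : Fin 2 => if i.val + j.val + 1 = 2 then (1 : L) else 0)).Local v × (UnitaryGroup.cmDatum L 1 (Matrix.of fun i j : Fin 1 => if i.val + j.val + 1 = 1 then (1 : L) else 0)).Local v)) [ν.IsHaarMeasure] [ν.IsMulRightInvariant] :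
    ∀ (T : Subgroup ((UnitaryGroup.cmDatum L 2 (Matrix.of fun i j : Fin 2 => if i.val + j.val + 1 = 2 then (1 : L) else 0)).Local v × (UnitaryGroup.cmDatum L 1 (Matrix.of fun i j : Fin 1 => if i.val + j.val + 1 = 1 then (1 : L) else 0)).Local v)) (γ₀ : ((UnitaryGroup.cmDatum L 2 (Matrix.of fun i j : Fin 2 => if i.val + j.val + 1 = 2 then (1 : L) else 0)).Local v × (UnitaryGroup.cmDatum L 1 (Matrix.of fun i j : Fin 1 => if i.val + j.val + 1 = 1 then (1 : L) else 0)).Local v)) (_ : IsLocalGRegular L v γ₀) (_ : T = Subgroup.centralizer ({γ₀} : Set ((UnitaryGroup.cmDatum L 2 (Matrix.of fun i j : Fin 2 => if i.val + j.val + 1 = 2 then (1 : L) else 0)).Local v × (UnitaryGroup.cmDatum L 1 (Matrix.of fun i j : Fin 1 => if i.val + j.val + 1 = 1 then (1 : L) else 0)).Local v))) (hTcpt : IsCompact (T : Set ((UnitaryGroup.cmDatum L 2 (Matrix.of fun i j : Fin 2 => if i.val + j.val + 1 = 2 then (1 : L) else 0)).Local v × (UnitaryGroup.cmDatum L 1 (Matrix.of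 fun i j : Fin 1 => if i.val + j.val + 1 = 1 then (1 : L) else 0)).Local v))),
      (letI : MeasurableSpace (((UnitaryGroup.cmDatum L 2 (Matrix.of fun i j : Fin 2 => if i.val + j.val + 1 = 2 then (1 : L) else 0)).Local v × (UnitaryGroup.cmDatum L 1 (Matrix.of fun i j : Fin 1 => if i.val + j.val + 1 = 1 then (1 : L) else 0)).Local v) ⧸ T) := borel _
      haveI : BorelSpace (((UnitaryGroup.cmDatum L 2 (Matrix.of fun i j : Fin 2 => if i.val + j.val + 1 = 2 then (1 : L) else 0)).Local v × (UnitaryGroup.cmDatum L 1 (Matrix.of fun i j : Fin 1 => if i.val + j.val + 1 = 1 then (1 : L) else 0)).Local v) ⧸ T) := ⟨rfl⟩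
      ∀ (tT : Measure ↥T) (_ : tT.IsHaarMeasure) (_ : tT.IsInvInvariant), tT (compactCore ↥T) = 1 →
        ∀ t₀ : ↥T, IsLocalGRegular L v (t₀ : ((UnitaryGroup.cmDatum L 2 (Matrix.of fun i j : Fin 2 => if i.val + j.val + 1 = 2 then (1 : L) else 0)).Local v × (UnitaryGroup.cmDatum L 1 (Matrix.of fun i j : Fin 1 => if i.val + j.val + 1 = 1 then (1 : L) else 0)).Local v)) →
        ∃ U : Set ↥T, IsOpen U ∧ t₀ ∈ U ∧
        ∃ A₀ : Set (((UnitaryGroup.cmDatum L 2 (Matrix.of fun i j : Fin 2 => if i.val + j.val + 1 = 2 then (1 : L) else 0)).Local v × (UnitaryGroup.cmDatum L 1 (Matrix.of fun i j : Fin 1 => if i.val + j.val + 1 = 1 then (1 : L) else 0)).Local v) ⧸ T), MeasurableSet A₀ ∧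
          quotientMeasure T tT hTcpt.isClosed ν A₀ ≠ 0 ∧ quotientMeasure T tT hTcpt.isClosed ν A₀ ≠ ∞ ∧
          ∀ V : Set ↥T, MeasurableSet V → V ⊆ U →
            (∀ t ∈ V, IsLocalGRegular L v (t : ((UnitaryGroup.cmDatum L 2 (Matrix.of fun i j : Fin 2 => if i.val + j.val + 1 = 2 then (1 : L) else 0)).Local v × (UnitaryGroup.cmDatum L 1 (Matrix.of fun i j : Fin 1 => if i.val + j.val + 1 = 1 then (1 : L) else 0)).Local v))) →
            (∀ n : ((UnitaryGroup.cmDatum L 2 (Matrix.of fun i j : Fin 2 => if i.val + j.val + 1 = 2 then (1 : L) else 0)).Local v × (UnitaryGroup.cmDatum L 1 (Matrix.of fun i j : Fin 1 => if i.val + j.val + 1 = 1 then (1 : L) else 0)).Local v), n ∉ T → ∀ t ∈ V, ∀ t' ∈ V, ((t' : ↥T) : ((UnitaryGroup.cmDatum L 2 (Matrix.of fun i j : Fin 2 => if i.val + j.val + 1 = 2 then (1 : L) else 0)).Local v × (UnitaryGroup.cmDatum L 1 (Matrix.of fun i j : Fin 1 => if i.val + j.val + 1 = 1 then (1 : L)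 else 0)).Local v)) ≠ n * t * n⁻¹) →
              ν {y : ((UnitaryGroup.cmDatum L 2 (Matrix.of fun i j : Fin 2 => if i.val + j.val + 1 = 2 then (1 : L) else 0)).Local v × (UnitaryGroup.cmDatum L 1 (Matrix.of fun i j : Fin 1 => if i.val + j.val + 1 = 1 then (1 : L) else 0)).Local v) | ∃ (x : ((UnitaryGroup.cmDatum L 2 (Matrix.of fun i j : Fin 2 => if i.val + j.val + 1 = 2 then (1 : L) else 0)).Local v × (UnitaryGroup.cmDatum L 1 (Matrix.of fun i j : Fin 1 => if i.val + j.val + 1 = 1 then (1 : L) else 0)).Local v)) (t : ↥T), (QuotientGroup.mk x : ((UnitaryGroup.cmDatum L 2 (Matrix.of fun i j : Fin 2 => if i.val + j.val + 1 = 2 then (1 : L) else 0)).Local v × (UnitaryGroup.cmDatum L 1 (Matrix.of fun i j : Fin 1 => if i.val + j.val + 1 = 1 then (1 : L) else 0)).Local v) ⧸ T) ∈ A₀ ∧ t ∈ V ∧ y = x * t * x⁻¹} =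
                quotientMeasure T tT hTcpt.isClosed ν A₀ *
                  ∫⁻ t in V, ((NNReal.sqrt ((∏ w : PlacesOver L v, Literature.NumberTheory.GaloisRepresentations.IsNonarchimedeanLocalField.normAbs (w.1.adicCompletion L) (((((t : ((UnitaryGroup.cmDatum L 2 (Matrix.of fun i j : Fin 2 => if i.val + j.val + 1 = 2 then (1 : L) else 0)).Local v × (UnitaryGroup.cmDatum L 1 (Matrix.of fun i j : Fin 1 => if i.val + j.val + 1 = 1 then (1 : L) else 0)).Local v)).1.val : GL (Fin 2) (UnitaryGroup.LocalRing L v))).val.charpoly.discr) w)) * (∏ w : PlacesOver L v, Literature.NumberTheory.GaloisRepresentations.IsNonarchimedeanLocalField.normAbs (w.1.adicCompletion L) (((((t : ((UnitaryGroup.cmDatum L 2 (Matrix.of fun i j : Fin 2 => if i.val + j.val + 1 = 2 then (1 : L) else 0)).Local v × (UnitaryGroup.cmDatum L 1 (Matrix.of fun i j : Fin 1 => if i.val + j.val + 1 = 1 then (1 : L) else 0)).Local v)).1.val : GL (Fin 2) (UnitaryGroup.LocalRing L v))).val.det) w))⁻¹) : ℝ≥0) : ℝ≥0∞) ∂tT)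 := by
  intro T γ₀ hγ₀ hT hTcpt
  obtain ⟨w⟩ := (inferInstance : Nonempty (PlacesOver L v))
  refine tubeJacobianSocket_compactCartan_H_of_dock L v hns ?_ ν T γ₀ hγ₀ hT hTcpt
  intro instM₂ instB₂ T₂ g₀ hT₂ hreg hT₂cpt Φ₂ hΦ₂ instQM instQB ν₂ _ _ tm₂ _ _ _ _
  exact F0P3cStCharTSJacCartanWeightDockTwo.tubeJacobianLocal_cartan_U2_elliptic L v w (hns w) hT₂ hreg hT₂cpt Φ₂ hΦ₂ hT₂cpt.isClosed ν₂ tm₂ _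
    (fun _ => rfl)

end CM

end Summit.HodgeConjecture.HodgeConjecture.Cruxes.H413.F0P3cStCharTSUpTrJacCartanCompactH

end
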